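import Mathlib.Topology.KrullDimension
import Mathlib.Order.KrullDimension
import Literature.AlgebraicGeometry.Motives.GrothendieckVanishingProofs
import HarnessLib

/-!
# The subset dimension `sdim` of a closed subset is the Krull dimension of the subspace

Grothendieck's vanishing theorem with supports
(`Literature/AlgebraicGeometry/Motives/GrothendieckVanishingProofs`,
`GrothendieckVanishingProof.VanishingOn Y`: `Hⁱ(X, G) = 0` for every abelian sheaf `G` supported on
the closed subset `Y ⊆ X` and every `i > sdim Y`) measures `Y` *inside* `X`:
`sdim Y = krullDim {Z : IrreducibleCloseds X // ↑Z ⊆ Y}` is the supremum of the lengths of chains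
of irreducible closed subsets *of the ambient space* `X` contained in `Y`. Consumers know instead
the dimension of `Y` as a topological space in its own right (Mathlib `topologicalKrullDim ↥Y`,
chains of irreducible closed subsets of the subspace), typically for `Y` the underlying space of a
closed subscheme — e.g. the special fibre of a scheme over a discrete valuation ring — embedded by
a closed immersion. This file is the bridge (Hartshorne I.1, p. 5: the dimension of a closed subset
is its dimension as a topological space with the induced topology; I Ex. 1.10):

* `isIrreducible_preimage_of_isEmbedding` — an irreducible subset of the range of an embedding has
  irreducible preimage;
* `exists_orderIso_irreducibleCloseds_of_isClosedEmbedding` — for a closed embedding `f : Y' → X`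
  and any `C ⊆ Y'`, `T ↦ f '' T` (inverse `Z ↦ f ⁻¹' Z`) is an order isomorphism between the
  irreducible closed subsets of `Y'` contained in `C` and the irreducible closed subsets of `X`
  contained in `f '' C`; hence
* `sdim_image_of_isClosedEmbedding` — **invariance under closed embeddings**:
  `sdim (f '' C) = sdim C`, and `sdim_range_of_isClosedEmbedding`:
  `sdim (range f) = topologicalKrullDim Y'`;
* `sdim_eq_topologicalKrullDim_of_isClosed` — for `Y ⊆ X` closed,
  `sdim Y = topologicalKrullDim ↥Y`, and `sdim_image_val_of_isClosed`: subsets of a closed `Y` have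
  the same `sdim` in `↥Y` and in `X`;
* `sdim_le_topologicalKrullDim` — `sdim Y ≤ dim X` for every subset `Y`;
* the `ℕ`-valued forms in the hypothesis shape of `VanishingOn` (`∀ i : ℕ, sdim Y < i → …`):
  `sdim_range_le_of_topologicalKrullDim_le`, `sdim_range_lt_of_topologicalKrullDim_le`,
  `sdim_le_of_isClosed_of_topologicalKrullDim_le`, `sdim_lt_of_isClosed_of_topologicalKrullDim_le`
  (`dim ≤ d < i ⇒ sdim < i`).

For a non-closed subset the two numbers differ in general (for a non-closed point `η` of an
irreducible curve, `sdim {η} = ⊥` while the subspace `{η}` has dimension `0`), whence the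
closedness hypotheses. Everything is proved ([folklore] order-theoretic bookkeeping around
Mathlib's `IrreducibleCloseds`, `Order.krullDim_eq_of_orderIso`, `IsClosedEmbedding`); theorems
only. NOT here: schemes, closed immersions, noetherian hypotheses (none are needed), and the
comparison with the Krull dimension of local rings.

## References

* R. Hartshorne, *Algebraic Geometry*, GTM 52, Springer (1977), I.1 (definition of the dimension
  of a topological space and of its closed subsets, p. 5) and I Ex. 1.10. [Hartshorne1977]
-/

open Order TopologicalSpace Set

namespace Literature.Topology

open _root_.Topology Literature.AlgebraicGeometry.Motives

variable {X Y' : Type*} [TopologicalSpace X] [TopologicalSpace Y']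

/-! ### Irreducible closed subsets under (closed) embeddings -/

/-- The preimage under an embedding `e` of an irreducible set `t ⊆ range e` is irreducible:
nonempty opens of the source are traces of opens of the target, and `t` meets any two opens it
meets separately in a common point, which lies in the range. [folklore] -/
theorem isIrreducible_preimage_of_isEmbedding {e : Y' → X} (he : IsEmbedding e) {t : Set X}
    (ht : IsIrreducible t) (hte : t ⊆ range e) : IsIrreducible (e ⁻¹' t) := by
  refine ⟨?_, ?_⟩
  · obtain ⟨x, hx⟩ := ht.nonempty
    obtain ⟨y, rfl⟩ := hte hx
    exact ⟨y, hx⟩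
  · intro u v hu hv h₁ h₂
    obtain ⟨y₁, hy₁t, hy₁u⟩ := h₁
    obtain ⟨y₂, hy₂t, hy₂v⟩ := h₂
    obtain ⟨u', hu', rfl⟩ := he.isInducing.isOpen_iff.mp hu
    obtain ⟨v', hv', rfl⟩ := he.isInducing.isOpen_iff.mp hv
    obtain ⟨x, hxt, hxu', hxv'⟩ :=
      ht.isPreirreducible u' v' hu' hv' ⟨e y₁, hy₁t, hy₁u⟩ ⟨e y₂, hy₂t, hy₂v⟩
    obtain ⟨y, rfl⟩ := hte hxt
    exact ⟨y, hxt, hxu', hxv'⟩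

/-- For a closed embedding `f : Y' → X` and any subset `C ⊆ Y'`, direct image `T ↦ f '' T` and
inverse image `Z ↦ f ⁻¹' Z` are mutually inverse order isomorphisms between the irreducible closed
subsets of `Y'` contained in `C` and the irreducible closed subsets of `X` contained in `f '' C`
(a closed embedding is a homeomorphism onto a closed subspace, so it preserves and reflects
"irreducible closed"). Stated as an existence with the characterising property
`↑(e T) = f '' ↑T`. [folklore] -/
theorem exists_orderIso_irreducibleCloseds_of_isClosedEmbedding {f : Y' → X}
    (hf : IsClosedEmbedding f) (C : Set Y') :
    ∃ e : {T : IrreducibleCloseds Y' // (T : Set Y') ⊆ C} ≃o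
        {Z : IrreducibleCloseds X // (Z : Set X) ⊆ f '' C},
      ∀ T, (((e T).1 : IrreducibleCloseds X) : Set X) = f '' (T.1 : Set Y') := by
  refine ⟨{ toFun := fun T => ⟨⟨f '' (T.1 : Set Y'),
              T.1.isIrreducible.image f hf.continuous.continuousOn, hf.isClosedMap _ T.1.isClosed⟩,
              image_mono T.2⟩
            invFun := fun Z => ⟨⟨f ⁻¹' (Z.1 : Set X),
              isIrreducible_preimage_of_isEmbedding hf.isEmbedding Z.1.isIrreducible
                (Z.2.trans (image_subset_range f C)), Z.1.isClosed.preimage hf.continuous⟩,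
              (preimage_mono Z.2).trans (hf.injective.preimage_image C).subset⟩
            left_inv := fun T => Subtype.ext (IrreducibleCloseds.ext
              (hf.injective.preimage_image _))
            right_inv := fun Z => Subtype.ext (IrreducibleCloseds.ext
              (image_preimage_eq_of_subset (Z.2.trans (image_subset_range f C))))
            map_rel_iff' := fun {a b} => by
              change f '' (a.1 : Set Y') ⊆ f '' (b.1 : Set Y') ↔ (a.1 : Set Y') ⊆ (b.1 : Set Y')
              exact image_subset_image_iff hf.injective }, fun T => rfl⟩

/-! ### `sdim` under closed embeddings and for closed subsets -/

/-- **`sdim` is invariant under closed embeddings**: for a closed embedding `f : Y' → X` and any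
`C ⊆ Y'`, the dimension of `f '' C` measured by chains of irreducible closed subsets of `X` equals
the dimension of `C` measured by chains of irreducible closed subsets of `Y'`. [folklore] -/
theorem sdim_image_of_isClosedEmbedding {f : Y' → X} (hf : IsClosedEmbedding f) (C : Set Y') :
    sdim (f '' C) = sdim C := by
  obtain ⟨e, -⟩ := exists_orderIso_irreducibleCloseds_of_isClosedEmbedding hf C
  exact (krullDim_eq_of_orderIso e).symm

/-- **The dimension of a closed subspace is computed by chains in the ambient space**
(Hartshorne I.1, p. 5, and I Ex. 1.10): for a closed embedding `f : Y' → X`, the supremum of the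
lengths of chains of irreducible closed subsets of `X` contained in `range f` is the Krull
dimension of the topological space `Y'`. [cite: Hartshorne1977, I Ex. 1.10] -/
theorem sdim_range_of_isClosedEmbedding {f : Y' → X} (hf : IsClosedEmbedding f) :
    sdim (range f) = topologicalKrullDim Y' := by
  rw [← image_univ, sdim_image_of_isClosedEmbedding hf, sdim_univ]

/-- For a closed subset `Y ⊆ X`, `sdim Y` (chains of irreducible closed subsets of `X` inside `Y`)
is the Krull dimension of the subspace `↥Y` (Hartshorne I.1, p. 5: "the dimension of a closed
subset is its dimension as a topological space with the induced topology").
[cite: Hartshorne1977, I Ex. 1.10] -/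
theorem sdim_eq_topologicalKrullDim_of_isClosed {Y : Set X} (hY : IsClosed Y) :
    sdim Y = topologicalKrullDim Y := by
  rw [← sdim_range_of_isClosedEmbedding hY.isClosedEmbedding_subtypeVal, Subtype.range_coe]

/-- Subsets of a closed subset `Y ⊆ X` have the same `sdim` whether measured in the subspace `↥Y`
or in `X`. [folklore] -/
theorem sdim_image_val_of_isClosed {Y : Set X} (hY : IsClosed Y) (C : Set Y) :
    sdim (((↑) : Y → X) '' C) = sdim C :=
  sdim_image_of_isClosedEmbedding hY.isClosedEmbedding_subtypeVal C

/-- `sdim Y ≤ dim X` for every subset `Y ⊆ X`. [folklore] -/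
theorem sdim_le_topologicalKrullDim (Y : Set X) : sdim Y ≤ topologicalKrullDim X :=
  (sdim_mono (subset_univ Y)).trans_eq sdim_univ

/-- The Krull dimension of a subspace bounds its `sdim`: `sdim Y ≤ topologicalKrullDim ↥Y` for
every subset `Y` (with equality for `Y` closed, `sdim_eq_topologicalKrullDim_of_isClosed`).
[folklore] -/
theorem sdim_le_topologicalKrullDim_subtype (Y : Set X) : sdim Y ≤ topologicalKrullDim Y := by
  refine krullDim_le_of_strictMono
    (fun Z : {Z : IrreducibleCloseds X // (Z : Set X) ⊆ Y} =>
      (⟨((↑) : Y → X) ⁻¹' (Z.1 : Set X),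
        isIrreducible_preimage_of_isEmbedding IsEmbedding.subtypeVal Z.1.isIrreducible
          (by rw [Subtype.range_coe]; exact Z.2),
        Z.1.isClosed.preimage continuous_subtype_val⟩ : IrreducibleCloseds Y)) ?_
  intro a b hab
  refine lt_of_le_of_ne (fun y hy => hab.le hy) fun h => hab.ne (Subtype.ext
    (IrreducibleCloseds.ext ?_))
  have h' := congr_arg (fun T : IrreducibleCloseds Y => ((↑) : Y → X) '' (T : Set Y)) h
  simp only [IrreducibleCloseds.coe_mk, image_preimage_eq_inter_range, Subtype.range_coe,
    inter_eq_left.mpr a.2, inter_eq_left.mpr b.2] at h'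
  exact h'

/-! ### `ℕ`-valued forms (the hypothesis shape `sdim Y < i` of `VanishingOn`) -/

/-- If `dim Y' ≤ d` then `sdim (range f) ≤ d` for a closed embedding `f : Y' → X`. [folklore] -/
theorem sdim_range_le_of_topologicalKrullDim_le {f : Y' → X} (hf : IsClosedEmbedding f)
    {d : WithBot ℕ∞} (hd : topologicalKrullDim Y' ≤ d) : sdim (range f) ≤ d :=
  (sdim_range_of_isClosedEmbedding hf).trans_le hd

/-- If `dim Y' ≤ d < i` (`d i : ℕ`) then `sdim (range f) < i` for a closed embedding `f : Y' → X`: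
the hypothesis under which `GrothendieckVanishingProof.VanishingOn (range f)` yields
`Hⁱ(X, G) = 0` for sheaves supported on `range f`. [folklore] -/
theorem sdim_range_lt_of_topologicalKrullDim_le {f : Y' → X} (hf : IsClosedEmbedding f)
    {d i : ℕ} (hd : topologicalKrullDim Y' ≤ d) (hdi : d < i) : sdim (range f) < i :=
  (sdim_range_le_of_topologicalKrullDim_le hf hd).trans_lt (by exact_mod_cast hdi)

/-- If `Y ⊆ X` is closed with `dim ↥Y ≤ d` then `sdim Y ≤ d`. [folklore] -/
theorem sdim_le_of_isClosed_of_topologicalKrullDim_le {Y : Set X} (hY : IsClosed Y)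
    {d : WithBot ℕ∞} (hd : topologicalKrullDim Y ≤ d) : sdim Y ≤ d :=
  (sdim_eq_topologicalKrullDim_of_isClosed hY).trans_le hd

/-- If `Y ⊆ X` is closed with `dim ↥Y ≤ d < i` (`d i : ℕ`) then `sdim Y < i`. [folklore] -/
theorem sdim_lt_of_isClosed_of_topologicalKrullDim_le {Y : Set X} (hY : IsClosed Y) {d i : ℕ}
    (hd : topologicalKrullDim Y ≤ d) (hdi : d < i) : sdim Y < i :=
  (sdim_le_of_isClosed_of_topologicalKrullDim_le hY hd).trans_lt (by exact_mod_cast hdi)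

end Literature.Topology
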